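import Summits.CriticalPhenomena.Ising3DConformalLimit.Theses.EnergyNotSigmaSquared
import Summits.CriticalPhenomena.Ising3DConformalLimit.Theorems.GapForcesFarMerging.Negative.IsingCertificate
import Summits.CriticalPhenomena.Ising3DConformalLimit.Theorems.MoebiusLimitExists.Negative.FreePermutations
import Literature.Probability.LatticeModels.FreeBoundaryReflectionPositivity
import Literature.Probability.LatticeModels.MessagerMiracleSole
import Literature.Probability.LatticeModels.CriticalCorrWellDefined
import HarnessLib

/-!
# Reflection positivity un-pinching: the `2 × 2` Gram minor of the critical state through a site plane
(line `rp-unpinch-single-passage` of crux `GapForcesFarMerging`, item stmt-CriticalPhenomena-4468,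
route `EnergyNotSigmaSquared`; stub `stub_rpUnpinch`)

For the critical nearest-neighbour Ising state on `ℤ³` and the reflection `θ : x₀ ↦ 2m - x₀`
through the SITE plane `{x₀ = m}` (`m : ℕ`), the energy row `F = σ₀σ_{e₂} - ⟨σ₀σ_{e₂}⟩` and a pair
row `G = σ_{θy}σ_{θz} - ⟨σ_yσ_z⟩` with `y₀, z₀ ≥ m` both live in the half `{x₀ ≤ m}`, and reflection
positivity of the state (Fröhlich–Israel–Lieb–Simon 1978, Thm. 2.1 / §2) says that
`B(X, Y) := ⟨(X ∘ θ*) · Y⟩` is positive semidefinite on such observables; its `2 × 2` Gram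
(Cauchy–Schwarz) minor `B(F,G)² ≤ B(F,F) · B(G,G)` is, by the lattice symmetries of the critical
state, the inequality `stub_rpUnpinch` between three truncated correlations.

Proof (all ingredients are tree theorems).
* Finite volume: the free Gibbs measure of the centred box `box 3 L` is reflection positive through
  the site plane `{x₀ = 0}` (`isingExpect_free_reflect_mul_self_nonneg` with `θ₀ = axisRefl 0 0`,
  half `{x₀ ≤ 0}`), applied to `F_t = (σ_aσ_b - α) + t (σ_{θ₀p}σ_{θ₀q} - γ)` for every real `t`.
* `⟨(F_t ∘ θ₀*) F_t⟩^∅_{box L; β_c}` is a quadratic polynomial in `t` whose coefficients are finite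
  combinations of box expectations of spin monomials; these converge to the critical correlators
  (`criticalCorr_wellDefined_holds`, free boundary condition), so the limit polynomial is `≥ 0`
  for every `t`, and `discrim_le_zero` gives the Gram inequality at the plane `{x₀ = 0}`.
* The plane `{x₀ = m}` is reached by translating by `m e₁` (`criticalCorr_translate`); the mixed
  terms are identified by `θ₀`-invariance (`criticalCorr_signedPerm` + `criticalCorr_translate`)
  and relabelling (`criticalCorr_comp_perm`).

References: J. Fröhlich, R. Israel, E. H. Lieb, B. Simon, Comm. Math. Phys. 62 (1978) 1–34, §2,
Thm. 2.1 [FILS1978]; S. Friedli, Y. Velenik, *Statistical Mechanics of Lattice Systems* (CUP 2017),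
Lemma 10.8 [FriedliVelenik2017].
-/

noncomputable section

namespace Summit.CriticalPhenomena.Ising3DConformalLimit.EnergyNotSigmaSquaredGapForcesFarMerging

open MeasureTheory Filter
open scoped Topology
open Literature.Probability.LatticeModels
open Summit.CriticalPhenomena.Ising3DConformalLimit.Theses.EnergyNotSigmaSquared
open Summit.CriticalPhenomena.Ising3DConformalLimit.Theorems.GapForcesFarMerging.Negative (e₁ e₂ cc2 FarMergingShape)
open Summit.CriticalPhenomena.Ising3DConformalLimit.Theorems.GapForcesFarMerging.Negative
  (criticalCorr_comp_perm criticalCorr_translate)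
open Summit.CriticalPhenomena.Ising3DConformalLimit.MoebiusLimitExistsNegative (criticalCorr_signedPerm)

/-! ### Lattice symmetries of the critical correlators in `![…]` form -/

/-- The reflections `x₀ ↦ k - x₀` (a sign change of the first coordinate followed by a translation)
leave the critical correlators invariant. [cite: FriedliVelenik2017, Exercise 3.14, p. 115] -/
theorem criticalCorr_axisRefl {n : ℕ} (k : ℤ) (y : Fin n → Site 3) :
    criticalCorr 3 n (fun i => axisRefl 0 k (y i)) = criticalCorr 3 n y := by
  have h : (fun i => axisRefl (d := 3) 0 k (y i)) =
      fun i => Site.signedPerm (Equiv.refl (Fin 3)) (Function.update 1 0 (-1)) (y i) + Pi.single 0 k := rfl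
  rw [h, criticalCorr_translate (fun i => Site.signedPerm (Equiv.refl (Fin 3)) (Function.update 1 0 (-1)) (y i))
    (Pi.single 0 k), criticalCorr_signedPerm]

/-- Translation invariance of the critical four-point correlator. [cite: FriedliVelenik2017, Thm. 3.17] -/
theorem cc4_translate (a b c e v : Site 3) :
    criticalCorr 3 4 ![a + v, b + v, c + v, e + v] = criticalCorr 3 4 ![a, b, c, e] := by
  rw [← criticalCorr_translate ![a, b, c, e] v]
  congr 1
  funext i
  fin_cases i <;> rfl

/-- Translation invariance of the critical two-point correlator. [cite: FriedliVelenik2017, Thm. 3.17] -/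
theorem cc2_translate (a b v : Site 3) :
    criticalCorr 3 2 ![a + v, b + v] = criticalCorr 3 2 ![a, b] := by
  rw [← criticalCorr_translate ![a, b] v]
  congr 1
  funext i
  fin_cases i <;> rfl

/-- Reflection invariance (`θ₀`-images of all four points) of the critical four-point correlator.
[cite: FriedliVelenik2017, Exercise 3.14, p. 115] -/
theorem cc4_axisRefl (k : ℤ) (a b c e : Site 3) :
    criticalCorr 3 4 ![axisRefl 0 k a, axisRefl 0 k b, axisRefl 0 k c, axisRefl 0 k e] =
      criticalCorr 3 4 ![a, b, c, e] := by
  rw [← criticalCorr_axisRefl k ![a, b, c, e]]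
  congr 1
  funext i
  fin_cases i <;> rfl

/-- Reflection invariance of the critical two-point correlator. [cite: FriedliVelenik2017, Exercise 3.14, p. 115] -/
theorem cc2_axisRefl (k : ℤ) (a b : Site 3) :
    criticalCorr 3 2 ![axisRefl 0 k a, axisRefl 0 k b] = criticalCorr 3 2 ![a, b] := by
  rw [← criticalCorr_axisRefl k ![a, b]]
  congr 1
  funext i
  fin_cases i <;> rfl

/-- Relabelling: `⟨σ_cσ_eσ_aσ_b⟩ = ⟨σ_aσ_bσ_cσ_e⟩`. [folklore] -/
theorem cc4_swap (a b c e : Site 3) :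
    criticalCorr 3 4 ![c, e, a, b] = criticalCorr 3 4 ![a, b, c, e] := by
  rw [← criticalCorr_comp_perm ![a, b, c, e] ((Equiv.swap 0 2).trans (Equiv.swap 1 3))]
  congr 1
  funext i
  fin_cases i <;> rfl

/-! ### Box expectations of products of two centred pair observables -/

/-- The product `(σ_uσ_v - α)(σ_wσ_x - γ)` of two centred pair observables is measurable. [folklore] -/
theorem measurable_covProd (u v w x : Site 3) (α γ : ℝ) :
    Measurable fun σ : SpinConfig (Site 3) =>
      (spinAt u σ * spinAt v σ - α) * (spinAt w σ * spinAt x σ - γ) := by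
  fun_prop

/-- Linearity: the free box expectation of `(σ_uσ_v - α)(σ_wσ_x - γ)` in terms of expectations of
spin monomials. [folklore] -/
theorem isingExpect_covProd (Λ : Finset (Site 3)) (u v w x : Site 3) (α γ : ℝ) :
    isingExpect (zdGraph 3) Λ (criticalBeta 3) 0 .free
        (fun σ => (spinAt u σ * spinAt v σ - α) * (spinAt w σ * spinAt x σ - γ)) =
      isingExpect (zdGraph 3) Λ (criticalBeta 3) 0 .free (spinMonomial ![u, v, w, x]) -
        γ * isingExpect (zdGraph 3) Λ (criticalBeta 3) 0 .free (spinMonomial ![u, v]) -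
        α * isingExpect (zdGraph 3) Λ (criticalBeta 3) 0 .free (spinMonomial ![w, x]) + α * γ := by
  have hpt : (fun σ : SpinConfig (Site 3) =>
      (spinAt u σ * spinAt v σ - α) * (spinAt w σ * spinAt x σ - γ)) =
      fun σ => spinMonomial ![u, v, w, x] σ + ((-γ) * spinMonomial ![u, v] σ +
        ((-α) * spinMonomial ![w, x] σ + α * γ)) := by
    funext σ
    simp only [spinMonomial, Fin.prod_univ_four, Fin.prod_univ_two, Matrix.cons_val_zero,
      Matrix.cons_val_one, Matrix.cons_val]
    ring
  have m4 : Measurable (spinMonomial (V := Site 3) ![u, v, w, x]) := measurable_spinMonomial _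
  have m2 : Measurable fun σ : SpinConfig (Site 3) => (-γ) * spinMonomial ![u, v] σ :=
    (measurable_spinMonomial _).const_mul _
  have m2' : Measurable fun σ : SpinConfig (Site 3) => (-α) * spinMonomial ![w, x] σ :=
    (measurable_spinMonomial _).const_mul _
  have mc : Measurable fun _ : SpinConfig (Site 3) => α * γ := measurable_const
  rw [hpt, isingExpect_add' _ _ _ _ _ m4 (m2.fun_add (m2'.fun_add mc)), isingExpect_add' _ _ _ _ _ m2 (m2'.fun_add mc),
    isingExpect_add' _ _ _ _ _ m2' mc, isingExpect_const_mul' _ _ _ _ _ _ (measurable_spinMonomial _),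
    isingExpect_const_mul' _ _ _ _ _ _ (measurable_spinMonomial _), isingExpect_const]
  ring

/-- **Box limit** of `⟨(σ_uσ_v - α)(σ_wσ_x - γ)⟩^∅_{box L; β_c}`: the critical state is well defined
(`criticalCorr_wellDefined_holds`, free boundary condition). [cite: FriedliVelenik2017, Thm. 3.17, Lemma 3.23 and Thm. 3.28] -/
theorem tendsto_covProd (u v w x : Site 3) (α γ : ℝ) :
    Tendsto (fun L : ℕ => isingExpect (zdGraph 3) (box 3 L) (criticalBeta 3) 0 .free
        (fun σ => (spinAt u σ * spinAt v σ - α) * (spinAt w σ * spinAt x σ - γ))) atTop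
      (𝓝 (criticalCorr 3 4 ![u, v, w, x] - γ * criticalCorr 3 2 ![u, v] -
        α * criticalCorr 3 2 ![w, x] + α * γ)) := by
  simp only [isingExpect_covProd]
  have h4 : Tendsto (fun L : ℕ => isingExpect (zdGraph 3) (box 3 L) (criticalBeta 3) 0 .free
      (spinMonomial ![u, v, w, x])) atTop (𝓝 (criticalCorr 3 4 ![u, v, w, x])) :=
    criticalCorr_wellDefined_holds (d := 3) le_rfl 4 ![u, v, w, x] .free (by simp)
  have h2 : Tendsto (fun L : ℕ => isingExpect (zdGraph 3) (box 3 L) (criticalBeta 3) 0 .free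
      (spinMonomial ![u, v])) atTop (𝓝 (criticalCorr 3 2 ![u, v])) :=
    criticalCorr_wellDefined_holds (d := 3) le_rfl 2 ![u, v] .free (by simp)
  have h2' : Tendsto (fun L : ℕ => isingExpect (zdGraph 3) (box 3 L) (criticalBeta 3) 0 .free
      (spinMonomial ![w, x])) atTop (𝓝 (criticalCorr 3 2 ![w, x])) :=
    criticalCorr_wellDefined_holds (d := 3) le_rfl 2 ![w, x] .free (by simp)
  exact ((h4.sub (h2.const_mul γ)).sub (h2'.const_mul α)).add_const (α * γ)

/-! ### Reflection positivity of the free boxes through the site plane `{x₀ = 0}` -/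

/-- First coordinate of the reflected site: `(axisRefl 0 0 x)₀ = -x₀`. [folklore] -/
theorem axisRefl_zero_apply_zero (x : Site 3) : (axisRefl 0 0 x) 0 = -x 0 := by
  rw [axisRefl_apply, if_pos rfl, zero_sub]

/-- The other coordinates are unchanged: `(axisRefl 0 0 x)ⱼ = xⱼ` for `j ≠ 0`. [folklore] -/
theorem axisRefl_zero_apply_ne (x : Site 3) {j : Fin 3} (hj : j ≠ 0) : (axisRefl 0 0 x) j = x j := by
  rw [axisRefl_apply, if_neg hj]

/-- **Reflection positivity of the free critical boxes through `{x₀ = 0}`** (FILS 1978 §2 /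
Friedli–Velenik Lemma 10.8, the tree's `isingExpect_free_reflect_mul_self_nonneg`): for every
bounded measurable `F` depending only on the spins in `{x₀ ≤ 0}`,
`0 ≤ ⟨(F ∘ θ₀*) F⟩^∅_{box L; β_c, 0}`. [cite: FILS1978, Thm. 2.1] -/
theorem rp_box_nonneg (L : ℕ) {F : SpinConfig (Site 3) → ℝ} (hFm : Measurable F)
    (hFP : DependsOn F {w : Site 3 | w 0 ≤ 0}) (hFb : ∃ C, ∀ σ, |F σ| ≤ C) :
    0 ≤ isingExpect (zdGraph 3) (box 3 L) (criticalBeta 3) 0 .free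
      (fun τ => F (configReflect (axisRefl 0 0) τ) * F τ) := by
  refine isingExpect_free_reflect_mul_self_nonneg (zdGraph 3) (axisRefl 0 0) (axisRefl_involutive 0 0)
    (fun x y h => (zdGraph_adj_axisRefl 0 0 x y).2 h) (fun x => ⟨fun hx => ?_, fun hx => ?_⟩)
    (fun x => ?_) (fun x hx hθx => ?_) (fun x y hxy => ?_) _ _ hFm hFP hFb
  · simpa using axisRefl_mem_box 0 0 L x hx
  · simpa [axisRefl_involutive 0 0 x] using axisRefl_mem_box 0 0 L _ hx
  · simp only [Set.mem_setOf_eq, axisRefl_zero_apply_zero]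
    omega
  · simp only [Set.mem_setOf_eq, axisRefl_zero_apply_zero] at hx hθx
    funext j
    by_cases hj : j = 0
    · subst hj
      rw [axisRefl_zero_apply_zero]
      omega
    · exact axisRefl_zero_apply_ne x hj
  · obtain ⟨l, hl, hrest⟩ := zdGraph_adj_coord hxy
    simp only [Set.mem_setOf_eq, axisRefl_zero_apply_zero]
    by_cases hl0 : (0 : Fin 3) = l
    · subst hl0
      omega
    · have h0 := hrest 0 hl0
      omega

/-! ### The Gram inequality at the plane `{x₀ = 0}` -/

/-- **The RP quadratic form is nonnegative.** For sites `a, b` in the half `{x₀ ≤ 0}` and `p, q` in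
`{x₀ ≥ 0}`, the limit `L → ∞` of `⟨(F_t ∘ θ₀*) F_t⟩^∅_{box L; β_c} ≥ 0`,
`F_t = (σ_aσ_b - α) + t (σ_{θ₀p}σ_{θ₀q} - γ)`, written out as a quadratic polynomial in `t` with
critical-correlator coefficients. [cite: FILS1978, Thm. 2.1] -/
theorem rp_quadratic_nonneg (a b p q : Site 3) (ha : a 0 ≤ 0) (hb : b 0 ≤ 0) (hp : 0 ≤ p 0)
    (hq : 0 ≤ q 0) (α γ t : ℝ) :
    0 ≤ (criticalCorr 3 4 ![axisRefl 0 0 a, axisRefl 0 0 b, a, b] - α * criticalCorr 3 2 ![axisRefl 0 0 a, axisRefl 0 0 b] -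
          α * criticalCorr 3 2 ![a, b] + α * α) +
      (t * ((criticalCorr 3 4 ![axisRefl 0 0 a, axisRefl 0 0 b, axisRefl 0 0 p, axisRefl 0 0 q] - γ * criticalCorr 3 2 ![axisRefl 0 0 a, axisRefl 0 0 b] -
              α * criticalCorr 3 2 ![axisRefl 0 0 p, axisRefl 0 0 q] + α * γ) +
            (criticalCorr 3 4 ![p, q, a, b] - α * criticalCorr 3 2 ![p, q] -
              γ * criticalCorr 3 2 ![a, b] + γ * α)) +
        t ^ 2 * (criticalCorr 3 4 ![p, q, axisRefl 0 0 p, axisRefl 0 0 q] - γ * criticalCorr 3 2 ![p, q] -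
          γ * criticalCorr 3 2 ![axisRefl 0 0 p, axisRefl 0 0 q] + γ * γ)) := by
  have hθθ : ∀ x : Site 3, axisRefl 0 0 (axisRefl 0 0 x) = x := axisRefl_involutive 0 0
  -- the test observable, local in the half `{x₀ ≤ 0}`
  set F : SpinConfig (Site 3) → ℝ := fun σ =>
    (spinAt a σ * spinAt b σ - α) + t * (spinAt (axisRefl 0 0 p) σ * spinAt (axisRefl 0 0 q) σ - γ) with hF
  have hFm : Measurable F := by
    rw [hF]
    fun_prop
  have hFP : DependsOn F {w : Site 3 | w 0 ≤ 0} := by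
    intro σ τ hστ
    have hp' : axisRefl 0 0 p ∈ {w : Site 3 | w 0 ≤ 0} := by
      rw [Set.mem_setOf_eq, axisRefl_zero_apply_zero]; omega
    have hq' : axisRefl 0 0 q ∈ {w : Site 3 | w 0 ≤ 0} := by
      rw [Set.mem_setOf_eq, axisRefl_zero_apply_zero]; omega
    have h1 := hστ a ha
    have h2 := hστ b hb
    have h3 := hστ _ hp'
    have h4 := hστ _ hq'
    simp only [hF, spinAt, h1, h2, h3, h4]
  have hFb : ∃ C, ∀ σ, |F σ| ≤ C := by
    refine ⟨(1 + |α|) + |t| * (1 + |γ|), fun σ => ?_⟩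
    have e1 : |spinAt a σ * spinAt b σ - α| ≤ 1 + |α| := by
      refine (abs_sub _ _).trans ?_
      rw [abs_mul, abs_spinAt, abs_spinAt, one_mul]
    have e2 : |spinAt (axisRefl 0 0 p) σ * spinAt (axisRefl 0 0 q) σ - γ| ≤ 1 + |γ| := by
      refine (abs_sub _ _).trans ?_
      rw [abs_mul, abs_spinAt, abs_spinAt, one_mul]
    calc |F σ| ≤ |spinAt a σ * spinAt b σ - α| + |t * (spinAt (axisRefl 0 0 p) σ * spinAt (axisRefl 0 0 q) σ - γ)| :=
          abs_add_le _ _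
      _ ≤ (1 + |α|) + |t| * (1 + |γ|) := by
          rw [abs_mul]
          gcongr
  -- pointwise expansion of `(F ∘ θ₀*) · F`
  have hpt : (fun τ => F (configReflect (axisRefl 0 0) τ) * F τ) = fun τ =>
      (spinAt (axisRefl 0 0 a) τ * spinAt (axisRefl 0 0 b) τ - α) * (spinAt a τ * spinAt b τ - α) +
        (t * ((spinAt (axisRefl 0 0 a) τ * spinAt (axisRefl 0 0 b) τ - α) * (spinAt (axisRefl 0 0 p) τ * spinAt (axisRefl 0 0 q) τ - γ) +
              (spinAt p τ * spinAt q τ - γ) * (spinAt a τ * spinAt b τ - α)) +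
          t ^ 2 * ((spinAt p τ * spinAt q τ - γ) * (spinAt (axisRefl 0 0 p) τ * spinAt (axisRefl 0 0 q) τ - γ))) := by
    funext τ
    have h1 : ∀ x : Site 3, spinAt x (configReflect (axisRefl 0 0) τ) = spinAt (axisRefl 0 0 x) τ := fun x => rfl
    simp only [hF, h1, hθθ]
    ring
  -- linearity of the box expectations
  have hexp : ∀ L : ℕ, isingExpect (zdGraph 3) (box 3 L) (criticalBeta 3) 0 .free
      (fun τ => F (configReflect (axisRefl 0 0) τ) * F τ) =
      isingExpect (zdGraph 3) (box 3 L) (criticalBeta 3) 0 .free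
          (fun τ => (spinAt (axisRefl 0 0 a) τ * spinAt (axisRefl 0 0 b) τ - α) * (spinAt a τ * spinAt b τ - α)) +
        (t * (isingExpect (zdGraph 3) (box 3 L) (criticalBeta 3) 0 .free
                (fun τ => (spinAt (axisRefl 0 0 a) τ * spinAt (axisRefl 0 0 b) τ - α) *
                  (spinAt (axisRefl 0 0 p) τ * spinAt (axisRefl 0 0 q) τ - γ)) +
              isingExpect (zdGraph 3) (box 3 L) (criticalBeta 3) 0 .free
                (fun τ => (spinAt p τ * spinAt q τ - γ) * (spinAt a τ * spinAt b τ - α))) +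
          t ^ 2 * isingExpect (zdGraph 3) (box 3 L) (criticalBeta 3) 0 .free
            (fun τ => (spinAt p τ * spinAt q τ - γ) * (spinAt (axisRefl 0 0 p) τ * spinAt (axisRefl 0 0 q) τ - γ))) := by
    intro L
    have mff := measurable_covProd (axisRefl 0 0 a) (axisRefl 0 0 b) a b α α
    have mfg := measurable_covProd (axisRefl 0 0 a) (axisRefl 0 0 b) (axisRefl 0 0 p) (axisRefl 0 0 q) α γ
    have mgf := measurable_covProd p q a b γ α
    have mgg := measurable_covProd p q (axisRefl 0 0 p) (axisRefl 0 0 q) γ γ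
    rw [hpt, isingExpect_add' _ _ _ _ _ mff (((mfg.fun_add mgf).const_mul t).fun_add (mgg.const_mul (t ^ 2))),
      isingExpect_add' _ _ _ _ _ ((mfg.fun_add mgf).const_mul t) (mgg.const_mul (t ^ 2)),
      isingExpect_const_mul' _ _ _ _ _ _ (mfg.fun_add mgf), isingExpect_add' _ _ _ _ _ mfg mgf,
      isingExpect_const_mul' _ _ _ _ _ _ mgg]
  -- the limit `L → ∞`
  have hlim : Tendsto (fun L : ℕ => isingExpect (zdGraph 3) (box 3 L) (criticalBeta 3) 0 .free
      (fun τ => F (configReflect (axisRefl 0 0) τ) * F τ)) atTop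
      (𝓝 ((criticalCorr 3 4 ![axisRefl 0 0 a, axisRefl 0 0 b, a, b] - α * criticalCorr 3 2 ![axisRefl 0 0 a, axisRefl 0 0 b] -
          α * criticalCorr 3 2 ![a, b] + α * α) +
        (t * ((criticalCorr 3 4 ![axisRefl 0 0 a, axisRefl 0 0 b, axisRefl 0 0 p, axisRefl 0 0 q] - γ * criticalCorr 3 2 ![axisRefl 0 0 a, axisRefl 0 0 b] -
                α * criticalCorr 3 2 ![axisRefl 0 0 p, axisRefl 0 0 q] + α * γ) +
              (criticalCorr 3 4 ![p, q, a, b] - α * criticalCorr 3 2 ![p, q] -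
                γ * criticalCorr 3 2 ![a, b] + γ * α)) +
          t ^ 2 * (criticalCorr 3 4 ![p, q, axisRefl 0 0 p, axisRefl 0 0 q] - γ * criticalCorr 3 2 ![p, q] -
            γ * criticalCorr 3 2 ![axisRefl 0 0 p, axisRefl 0 0 q] + γ * γ)))) := by
    simp only [hexp]
    exact (tendsto_covProd (axisRefl 0 0 a) (axisRefl 0 0 b) a b α α).add
      ((((tendsto_covProd (axisRefl 0 0 a) (axisRefl 0 0 b) (axisRefl 0 0 p) (axisRefl 0 0 q) α γ).add (tendsto_covProd p q a b γ α)).const_mul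
        t).add ((tendsto_covProd p q (axisRefl 0 0 p) (axisRefl 0 0 q) γ γ).const_mul (t ^ 2)))
  exact ge_of_tendsto' hlim fun L => rp_box_nonneg L hFm hFP hFb

/-- **The Gram (Cauchy–Schwarz) minor of reflection positivity through `{x₀ = 0}`**: for `a, b`
in `{x₀ ≤ 0}` and `p, q` in `{x₀ ≥ 0}`,
`⟨σ_aσ_b ; σ_pσ_q⟩² ≤ ⟨σ_aσ_b ; σ_{θ₀a}σ_{θ₀b}⟩ · ⟨σ_{θ₀p}σ_{θ₀q} ; σ_pσ_q⟩`
(discriminant of the nonnegative RP quadratic form). [cite: FILS1978, Thm. 2.1] -/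
theorem rp_gram_plane_zero (a b p q : Site 3) (ha : a 0 ≤ 0) (hb : b 0 ≤ 0) (hp : 0 ≤ p 0)
    (hq : 0 ≤ q 0) :
    (criticalCorr 3 4 ![a, b, p, q] - criticalCorr 3 2 ![a, b] * criticalCorr 3 2 ![p, q]) ^ 2 ≤
      (criticalCorr 3 4 ![axisRefl 0 0 a, axisRefl 0 0 b, a, b] -
          criticalCorr 3 2 ![a, b] * criticalCorr 3 2 ![axisRefl 0 0 a, axisRefl 0 0 b]) *
        (criticalCorr 3 4 ![axisRefl 0 0 p, axisRefl 0 0 q, p, q] -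
          criticalCorr 3 2 ![axisRefl 0 0 p, axisRefl 0 0 q] * criticalCorr 3 2 ![p, q]) := by
  have h := rp_quadratic_nonneg a b p q ha hb hp hq (criticalCorr 3 2 ![a, b]) (criticalCorr 3 2 ![p, q])
  have e1 : criticalCorr 3 4 ![axisRefl 0 0 a, axisRefl 0 0 b, axisRefl 0 0 p, axisRefl 0 0 q] = criticalCorr 3 4 ![a, b, p, q] :=
    cc4_axisRefl 0 a b p q
  have e2 : criticalCorr 3 2 ![axisRefl 0 0 a, axisRefl 0 0 b] = criticalCorr 3 2 ![a, b] := cc2_axisRefl 0 a b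
  have e3 : criticalCorr 3 2 ![axisRefl 0 0 p, axisRefl 0 0 q] = criticalCorr 3 2 ![p, q] := cc2_axisRefl 0 p q
  have e4 : criticalCorr 3 4 ![p, q, a, b] = criticalCorr 3 4 ![a, b, p, q] := cc4_swap a b p q
  have e5 : criticalCorr 3 4 ![p, q, axisRefl 0 0 p, axisRefl 0 0 q] = criticalCorr 3 4 ![axisRefl 0 0 p, axisRefl 0 0 q, p, q] :=
    cc4_swap (axisRefl 0 0 p) (axisRefl 0 0 q) p q
  rw [e1, e2, e3, e4, e5] at h
  rw [e2, e3]
  set S := criticalCorr 3 4 ![a, b, p, q]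
  set α := criticalCorr 3 2 ![a, b]
  set γ := criticalCorr 3 2 ![p, q]
  set A := criticalCorr 3 4 ![axisRefl 0 0 a, axisRefl 0 0 b, a, b]
  set C := criticalCorr 3 4 ![axisRefl 0 0 p, axisRefl 0 0 q, p, q]
  have hquad : ∀ x : ℝ, 0 ≤ (C - γ * γ) * (x * x) + 2 * (S - α * γ) * x + (A - α * α) := by
    intro x
    have hx := h x
    linarith
  have hd := discrim_le_zero hquad
  rw [discrim] at hd
  nlinarith [hd]

/-! ### The stub: the Gram minor through the plane `{x₀ = m}` -/

/-- **Stub 1 (M) — RP un-pinching.** The `2×2` Gram minor (energy row × pair row) of reflection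
positivity of the critical state through the site plane `{x₀ = m}`: for all targets `y, z` with
`y₀, z₀ ≥ m`, `⟨σ₀σ_{e₂} ; σ_yσ_z⟩² ≤ ⟨σ₀σ_{e₂} ; σ_{2me₁}σ_{2me₁+e₂}⟩ · ⟨σ_{θy}σ_{θz} ; σ_yσ_z⟩`,
`θ : x₀ ↦ 2m - x₀` (the plane-`0` Gram inequality `rp_gram_plane_zero` translated by `m e₁`,
`criticalCorr_translate`). [cite: FILS1978, Thm. 2.1] -/
theorem stub_rpUnpinch :
    ∀ (m : ℕ) (y z : Site 3), (m : ℤ) ≤ y 0 → (m : ℤ) ≤ z 0 →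
      (criticalCorr 3 4 ![0, e₂, y, z] - criticalCorr 3 2 ![0, e₂] * criticalCorr 3 2 ![y, z]) ^ 2 ≤
        (criticalCorr 3 4 ![0, e₂, Pi.single 0 (2 * (m : ℤ)), Pi.single 0 (2 * (m : ℤ)) + e₂] - criticalCorr 3 2 ![0, e₂] * criticalCorr 3 2 ![Pi.single 0 (2 * (m : ℤ)), Pi.single 0 (2 * (m : ℤ)) + e₂]) *
          (criticalCorr 3 4 ![y - Pi.single 0 (2 * (y 0 - m)), z - Pi.single 0 (2 * (z 0 - m)), y, z] - criticalCorr 3 2 ![y - Pi.single 0 (2 * (y 0 - m)), z - Pi.single 0 (2 * (z 0 - m))] * criticalCorr 3 2 ![y, z]) := by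
  intro m y z hy hz
  -- shift by `v = m e₁`: the plane `{x₀ = m}` becomes `{x₀ = 0}`
  set v : Site 3 := Pi.single 0 (m : ℤ) with hv
  have hv0 : v 0 = (m : ℤ) := by simp [hv]
  have he0 : (e₂ : Site 3) 0 = 0 := by simp [e₂]
  have ha : ((0 : Site 3) - v) 0 ≤ 0 := by
    rw [Pi.sub_apply, Pi.zero_apply, hv0]; omega
  have hb : (e₂ - v) 0 ≤ 0 := by
    rw [Pi.sub_apply, he0, hv0]; omega
  have hp : 0 ≤ (y - v) 0 := by
    rw [Pi.sub_apply, hv0]; omega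
  have hq : 0 ≤ (z - v) 0 := by
    rw [Pi.sub_apply, hv0]; omega
  have key := rp_gram_plane_zero (0 - v) (e₂ - v) (y - v) (z - v) ha hb hp hq
  -- the reflected and shifted points
  have p5 : axisRefl 0 0 (0 - v) + v = Pi.single 0 (2 * (m : ℤ)) := by
    ext j
    fin_cases j <;> simp [axisRefl_apply, hv]
    ring
  have p6 : axisRefl 0 0 (e₂ - v) + v = Pi.single 0 (2 * (m : ℤ)) + e₂ := by
    ext j
    fin_cases j <;> simp [axisRefl_apply, hv, e₂]
    ring
  have p7 : axisRefl 0 0 (y - v) + v = y - Pi.single 0 (2 * (y 0 - m)) := by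
    ext j
    fin_cases j <;> simp [axisRefl_apply, hv]
    ring
  have p8 : axisRefl 0 0 (z - v) + v = z - Pi.single 0 (2 * (z 0 - m)) := by
    ext j
    fin_cases j <;> simp [axisRefl_apply, hv]
    ring
  rw [← cc4_translate (0 - v) (e₂ - v) (y - v) (z - v) v, ← cc2_translate (0 - v) (e₂ - v) v,
    ← cc2_translate (y - v) (z - v) v,
    ← cc4_translate (axisRefl 0 0 (0 - v)) (axisRefl 0 0 (e₂ - v)) (0 - v) (e₂ - v) v,
    ← cc2_translate (axisRefl 0 0 (0 - v)) (axisRefl 0 0 (e₂ - v)) v,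
    ← cc4_translate (axisRefl 0 0 (y - v)) (axisRefl 0 0 (z - v)) (y - v) (z - v) v,
    ← cc2_translate (axisRefl 0 0 (y - v)) (axisRefl 0 0 (z - v)) v] at key
  simp only [sub_add_cancel, p5, p6, p7, p8] at key
  rw [← cc4_swap (Pi.single 0 (2 * (m : ℤ)) : Site 3) _ (0 : Site 3) e₂] at key
  exact key

end Summit.CriticalPhenomena.Ising3DConformalLimit.EnergyNotSigmaSquaredGapForcesFarMerging

end
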